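import Summits.ValiantsHypothesis.ValiantsHypothesis.Theorems.LacunarySymmetroidMatrixDescartesDoorA26WallBubblingExpSumLocalSigns

/-!
# `DoorA26` / line `wall_bubbling` — SINGLE-CLUSTER KIT: iterated Rolle for exponential sums, limits of exponential sums at moving points,
Bolzano–Weierstrass for bounded zero vectors, COALESCENCE raises the vanishing order of the limit

HONEST FRAMING.  Object-search cell `pub-symmetroid`, crux `Theses.LacunarySymmetroid.DoorA26` (stmt-ValiantsHypothesis-19979; OPEN, typed,
never asserted).  W2 seat val-sym-door-p1 g19; def-free helper for obligation (R) of `Cruxes/DoorA26/Lines/wall_bubbling.lean`.  File #65 — the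
front-end of the single-cluster case of (R) (used by #66).  Imports #56 `…ExpSumLocalSigns` (for `iteratedDeriv_expSum`, `Bubbling.rolle_count`).

WHAT IS HERE.  K1 `exists_zeros_iteratedDeriv_expSum` / `exists_zero_iteratedDeriv_expSum_Icc` (iterated Rolle: the `s`-th derivative of `expSum a x`
keeps `|Z| − s` zeros in the window; `Bubbling.rolle_count` iterated with the closed form of the derivatives); K2 `tendsto_expSum`,
`tendsto_iteratedDeriv_expSum` (continuity in coefficients, exponents and the point, along sequences); K3 `iteratedDeriv_expSum_eq_zero_of_tendsto`
(zeros pass to the limit); K4 `exists_subseq_tendsto_of_bounded` (Bolzano–Weierstrass for `Fin n → ℝ`-valued sequences in a box, Mathlib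
`tendsto_subseq_of_bounded`), `monotone_of_tendsto`; ★ K5 `iteratedDeriv_eq_zero_of_coalesce`: if the sorted zeros `t ν i < … < t ν j` of a converging
family of exponential sums all tend to `w`, the limit sum vanishes at `w` to every order `s ≤ j − i`.  Nothing here bears on `DoorA26`, `DoorA34`, (W)/(M)/(R) as typed, `MatrixDescartes` (18050) or `VP ≠ VNP`; registers unchanged.

[folklore] Rolle, Bolzano–Weierstrass, continuity.  [this work] the packaging.
-/

set_option linter.dupNamespace false

namespace Summit.ValiantsHypothesis.ValiantsHypothesis.Theorems.LacunarySymmetroidMatrixDescartes.WallBubbling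

open Finset Filter Topology
open Bubbling (expSum hasDerivAt_expSum)

/-! ## K1 Iterated Rolle -/

/-- **Iterated Rolle for exponential sums.**  If `expSum a x` vanishes on a finite set `Z ⊆ [A, B]`, then for every `s` its `s`-th derivative
vanishes on a finite set `Z_s ⊆ [A, B]` with `|Z| ≤ |Z_s| + s`. [folklore] -/
theorem exists_zeros_iteratedDeriv_expSum {ι : Type*} [Fintype ι] (a x : ι → ℝ) (A B : ℝ) (Z : Finset ℝ)
    (hZ : ∀ z ∈ Z, z ∈ Set.Icc A B ∧ expSum a x z = 0) (s : ℕ) :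
    ∃ Zs : Finset ℝ, Z.card ≤ Zs.card + s ∧ ∀ z ∈ Zs, z ∈ Set.Icc A B ∧ iteratedDeriv s (expSum a x) z = 0 := by
  induction s with
  | zero => exact ⟨Z, by simp, fun z hz => ⟨(hZ z hz).1, by rw [iteratedDeriv_zero]; exact (hZ z hz).2⟩⟩
  | succ s ih =>
    obtain ⟨Zs, hcard, hZs⟩ := ih
    have hφ : ∀ t, HasDerivAt (iteratedDeriv s (expSum a x)) (iteratedDeriv (s + 1) (expSum a x) t) t := by
      intro t
      rw [iteratedDeriv_expSum, iteratedDeriv_expSum]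
      have := hasDerivAt_expSum (fun i => a i * x i ^ s) x t
      simp only [mul_assoc, ← pow_succ] at this
      exact this
    obtain ⟨Z', hcard', hZ'⟩ := Bubbling.rolle_count hφ A B Zs hZs
    exact ⟨Z', by omega, hZ'⟩

/-- Between the extreme elements of `n + 1` zeros of `expSum a x` there is, for every `s ≤ n`, a zero of the `s`-th derivative. [folklore] -/
theorem exists_zero_iteratedDeriv_expSum_Icc {ι : Type*} [Fintype ι] (a x : ι → ℝ) (A B : ℝ) (Z : Finset ℝ)
    (hZ : ∀ z ∈ Z, z ∈ Set.Icc A B ∧ expSum a x z = 0) (s : ℕ) (hs : s < Z.card) :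
    ∃ c ∈ Set.Icc A B, iteratedDeriv s (expSum a x) c = 0 := by
  obtain ⟨Zs, hcard, hZs⟩ := exists_zeros_iteratedDeriv_expSum a x A B Z hZ s
  have : Zs.Nonempty := Finset.card_pos.1 (by omega)
  obtain ⟨c, hc⟩ := this
  exact ⟨c, (hZs c hc).1, (hZs c hc).2⟩

/-! ## K2/K3 Limits of exponential sums at moving points -/

/-- **Continuity of exponential sums in (coefficients, exponents, point).** [folklore] -/
theorem tendsto_expSum {ι : Type*} [Fintype ι] {a x : ℕ → ι → ℝ} {A X : ι → ℝ} {t : ℕ → ℝ} {T : ℝ}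
    (ha : ∀ i, Tendsto (fun ν => a ν i) atTop (𝓝 (A i))) (hx : ∀ i, Tendsto (fun ν => x ν i) atTop (𝓝 (X i)))
    (ht : Tendsto t atTop (𝓝 T)) : Tendsto (fun ν => expSum (a ν) (x ν) (t ν)) atTop (𝓝 (expSum A X T)) := by
  simp only [expSum]
  refine tendsto_finsetSum _ fun i _ => ?_
  exact (ha i).mul ((Real.continuous_exp.tendsto _).comp ((hx i).mul ht))

/-- The `s`-th derivatives converge too (closed form `iteratedDeriv_expSum`). [folklore] -/
theorem tendsto_iteratedDeriv_expSum {ι : Type*} [Fintype ι] {a x : ℕ → ι → ℝ} {A X : ι → ℝ} {t : ℕ → ℝ} {T : ℝ}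
    (ha : ∀ i, Tendsto (fun ν => a ν i) atTop (𝓝 (A i))) (hx : ∀ i, Tendsto (fun ν => x ν i) atTop (𝓝 (X i)))
    (ht : Tendsto t atTop (𝓝 T)) (s : ℕ) :
    Tendsto (fun ν => iteratedDeriv s (expSum (a ν) (x ν)) (t ν)) atTop (𝓝 (iteratedDeriv s (expSum A X) T)) := by
  simp only [iteratedDeriv_expSum]
  exact tendsto_expSum (fun i => (ha i).mul ((hx i).pow s)) hx ht

/-- **Zeros pass to the limit.** [folklore] -/
theorem iteratedDeriv_expSum_eq_zero_of_tendsto {ι : Type*} [Fintype ι] {a x : ℕ → ι → ℝ} {A X : ι → ℝ} {t : ℕ → ℝ} {T : ℝ}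
    (ha : ∀ i, Tendsto (fun ν => a ν i) atTop (𝓝 (A i))) (hx : ∀ i, Tendsto (fun ν => x ν i) atTop (𝓝 (X i)))
    (ht : Tendsto t atTop (𝓝 T)) (s : ℕ) (hzero : ∀ ν, iteratedDeriv s (expSum (a ν) (x ν)) (t ν) = 0) :
    iteratedDeriv s (expSum A X) T = 0 := by
  have h := tendsto_iteratedDeriv_expSum ha hx ht s
  simp only [hzero] at h
  exact tendsto_nhds_unique tendsto_const_nhds h |>.symm

/-! ## K4 Converging subsequences of bounded zero vectors -/

/-- **Bolzano–Weierstrass for bounded families of finitely many sequences.**  A sequence of vectors `t ν : Fin n → ℝ` with all entries in `[−R, R]`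
has a subsequence converging entrywise. [folklore] -/
theorem exists_subseq_tendsto_of_bounded {n : ℕ} (t : ℕ → Fin n → ℝ) (R : ℝ) (ht : ∀ ν i, t ν i ∈ Set.Icc (-R) R) :
    ∃ (φ : ℕ → ℕ) (ζ : Fin n → ℝ), StrictMono φ ∧ ∀ i, Tendsto (fun ν => t (φ ν) i) atTop (𝓝 (ζ i)) := by
  have hbdd : Bornology.IsBounded (Set.pi Set.univ fun _ : Fin n => Set.Icc (-R) R) :=
    Bornology.IsBounded.pi fun _ => Metric.isBounded_Icc (-R) R
  obtain ⟨ζ, -, φ, hφ, hlim⟩ := tendsto_subseq_of_bounded hbdd (x := t) (fun ν => Set.mem_univ_pi.2 fun i => ht ν i)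
  exact ⟨φ, ζ, hφ, fun i => (tendsto_pi_nhds.1 hlim) i⟩

/-- Limits of ordered vectors are ordered. [folklore] -/
theorem monotone_of_tendsto {n : ℕ} (t : ℕ → Fin n → ℝ) (ζ : Fin n → ℝ) (hmono : ∀ ν, Monotone (t ν))
    (hlim : ∀ i, Tendsto (fun ν => t ν i) atTop (𝓝 (ζ i))) : Monotone ζ :=
  fun i j hij => le_of_tendsto_of_tendsto (hlim i) (hlim j) (Filter.Eventually.of_forall fun ν => hmono ν hij)

/-! ## K5 Coalescing zeros raise the vanishing order of the limit -/

/-- **Coalescence.**  Along a sequence of exponential sums with converging coefficients and exponents, if the sorted zeros `t ν i ≤ … ≤ t ν j`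
(`j − i + 1` of them, pairwise distinct for each `ν`) all converge to the same point `w`, then the limit sum vanishes at `w` to order `> j − i`:
`iteratedDeriv s (expSum A X) w = 0` for every `s ≤ j − i`. [folklore] -/
theorem iteratedDeriv_eq_zero_of_coalesce {ι : Type*} [Fintype ι] {n : ℕ} {a x : ℕ → ι → ℝ} {A X : ι → ℝ}
    (ha : ∀ i, Tendsto (fun ν => a ν i) atTop (𝓝 (A i))) (hx : ∀ i, Tendsto (fun ν => x ν i) atTop (𝓝 (X i)))
    (t : ℕ → Fin n → ℝ) (hmono : ∀ ν, StrictMono (t ν)) (hzero : ∀ ν k, expSum (a ν) (x ν) (t ν k) = 0)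
    (i j : Fin n) (hij : i ≤ j) (w : ℝ)
    (hi : Tendsto (fun ν => t ν i) atTop (𝓝 w)) (hj : Tendsto (fun ν => t ν j) atTop (𝓝 w))
    (s : ℕ) (hs : s ≤ (j : ℕ) - i) : iteratedDeriv s (expSum A X) w = 0 := by
  classical
  -- for each `ν`, a zero `c ν ∈ [t ν i, t ν j]` of the `s`-th derivative
  have hc : ∀ ν, ∃ c ∈ Set.Icc (t ν i) (t ν j), iteratedDeriv s (expSum (a ν) (x ν)) c = 0 := by
    intro ν
    set Z : Finset ℝ := (Finset.Icc i j).image (t ν) with hZ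
    have hZcard : Z.card = (j : ℕ) + 1 - i := by
      rw [hZ, Finset.card_image_of_injective _ (hmono ν).injective, Fin.card_Icc]
    refine exists_zero_iteratedDeriv_expSum_Icc (a ν) (x ν) (t ν i) (t ν j) Z (fun z hz => ?_) s (by rw [hZcard]; omega)
    obtain ⟨k, hk, rfl⟩ := Finset.mem_image.1 hz
    rw [Finset.mem_Icc] at hk
    exact ⟨⟨(hmono ν).monotone hk.1, (hmono ν).monotone hk.2⟩, hzero ν k⟩
  choose c hcI hc0 using hc
  have hclim : Tendsto c atTop (𝓝 w) :=
    tendsto_of_tendsto_of_tendsto_of_le_of_le hi hj (fun ν => (hcI ν).1) (fun ν => (hcI ν).2)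
  exact iteratedDeriv_expSum_eq_zero_of_tendsto ha hx hclim s hc0

end Summit.ValiantsHypothesis.ValiantsHypothesis.Theorems.LacunarySymmetroidMatrixDescartes.WallBubbling
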